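import Summits.CriticalPhenomena.PercolationContinuityZ3.Theorems.PercNearOneGluingNoHeavyLowerTailSahiCddBase
import HarnessLib

/-!
# The ONE-STEP BASE CERTIFICATE for the antithetic tower — definitions (generic first slot `H`)

Definitions file (prover prim-ineq-prove-3 gen 14; objects of the proof in memo `run/shared/lean/prim/prim-ineq-prove-3/FINDING-G14-ONESTEP-THRESHOLD.md` §1–2;
consumed by `…SahiOneStepPivot`, `…SahiOneStepTower`, `…SahiOneStep`).  Generalises `…SahiCddDefs` (gen 13: first slot = the OR event
`orEvent F`) to an ARBITRARY first event `H ⊆ 2^ι` (later assumed determined by a finite block `F`); the frozen sections `sec K x f` of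
`…SahiCddDefs` are reused.  Setting: `ι` finite, `p : ι → [0,1]`, the product weight `bernoulliWeight p` on `Set ι`, its expectation `ex`.

* `osT p H f g` — Sahi's `E₃(1_H, f, g)` as a bilinear form (`2E[1_H fg] − E[1_H f]Eg − E[1_H g]Ef − E[fg]E1_H + E1_H·Ef·Eg`; on indicators it is
  `sahiE3 (prodBernoulli p) H A B`);
* `osD p H h := E[(2·1_H − E1_H)·h]` — the decoupling-defect functional;
* `osP p H K f g := Σ_{x⊆K} [T(f^x,g^{K∖x}) + D(f^x(g^x − g^{K∖x}))]` — the ANTITHETIC TOWER functional (`osP p H ∅ = osT p H`);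
* `osCert p H u v := E[1_H u]E[1_H v] + (1 − E1_H)E[1_H uv]` — the CANONICAL ONE-STEP CERTIFICATE `d` (the gen-13 cdd certificate transplanted);
* `osMp p H f g := D(fg) − d(f,g)` (`m′`) and `osN p H f g := d(f,g) − [E[1_H f]Eg + E[1_H g]Ef − E1_H·Ef·Eg]` (`n`), so that `T = m′ + n`
  (`osT_eq_osMp_add_osN`); on up-set indicators `m′ ≥ 0` reads `Cov(1_{H∩A},1_{H∩B}) ≥ π(H)π(A∩B∖H)` and `n ≥ 0` reads
  `Cov(A,B) ≥ π(Hᶜ)·Cov(A,B ∣ Hᶜ)`;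
* `osM p H K f g := Σ_{x⊆K} [m′(f^x,g^x) + n(f^x,g^{K∖x})]` — the main part of the one-step identity `P_K = M_K + R_K`;
* `IsCoreFn F φ` — core test function (increasing, `[0,1]`-valued, determined by `F`); `OneStepPos p H F` — the hypothesis
  "`m′ ≥ 0` and `n ≥ 0` on all pairs of core test functions", under which `…SahiOneStep` proves `E₃(H, A, B) ≥ 0` for ALL increasing `A, B`.
-/

noncomputable section

namespace Summit.CriticalPhenomena.PercolationContinuityZ3.Theorems

namespace SahiOneStep

open Literature.Combinatorics.Sahi2008
open Literature.Probability.Percolation (DeterminedBy determinedBy_iff)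
open Literature.Probability.Percolation.DecisionTree (ind ind_of_mem ind_of_not_mem ind_nonneg)
open Literature.Probability.Percolation.BHK2006 (weight weight_nonneg blockFubini harris)
open Literature.Probability.LatticeModels (prodBernoulli sahiE3 sahiE3_def)
open SahiCdd (sec ex_congr' ex_lin2 ex_lin4 ex_split ex_mul_split sec_insert_of_not_mem sec_insert_insert
  sec_comp_insert sec_comp_sdiff sec_apply_insert sec_apply_sdiff monotone_sec dep_insert dep_sdiff ex_mul_le_ex_mul)

variable {ι : Type*} [Fintype ι] [DecidableEq ι]

/-! ## Definitions -/

/-- Sahi's `E₃(1_H, f, g)` as a bilinear form in `f, g` under the product weight, for an arbitrary first event `H`.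
[cite: LiebSahi2021, eq. (2.1) (arXiv p. 5)] -/
def osT (p : ι → unitInterval) (H : Set (Set ι)) (f g : Set ι → ℝ) : ℝ :=
  2 * ex (bernoulliWeight p) (ind H * f * g)
    - ex (bernoulliWeight p) (ind H * f) * ex (bernoulliWeight p) g
    - ex (bernoulliWeight p) (ind H * g) * ex (bernoulliWeight p) f
    - ex (bernoulliWeight p) (f * g) * ex (bernoulliWeight p) (ind H)
    + ex (bernoulliWeight p) (ind H) * ex (bernoulliWeight p) f * ex (bernoulliWeight p) g

/-- The decoupling-defect functional `D(h) = E[(2·1_H − E[1_H])·h]`. [this work] -/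
def osD (p : ι → unitInterval) (H : Set (Set ι)) (h : Set ι → ℝ) : ℝ :=
  ex (bernoulliWeight p) (fun ω => (2 * ind H ω - ex (bernoulliWeight p) (ind H)) * h ω)

/-- **The antithetic tower functional** `P_K(f,g) = Σ_{x ⊆ K} [T(f^x, g^{K∖x}) + D(f^x (g^x − g^{K∖x}))]` for the first event `H`
(`f^x = sec K x f` freezes the coordinates of `K` to the pattern `x`). [this work] -/
def osP (p : ι → unitInterval) (H : Set (Set ι)) (K : Finset ι) (f g : Set ι → ℝ) : ℝ :=
  ∑ x ∈ K.powerset,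
    (osT p H (sec K x f) (sec K (K \ x) g) + osD p H (sec K x f * (sec K x g - sec K (K \ x) g)))

/-- **The canonical one-step certificate** `d(u,v) = E[1_H u]·E[1_H v] + (1 − E[1_H])·E[1_H u v]`. [this work] -/
def osCert (p : ι → unitInterval) (H : Set (Set ι)) (u v : Set ι → ℝ) : ℝ :=
  ex (bernoulliWeight p) (ind H * u) * ex (bernoulliWeight p) (ind H * v)
    + (1 - ex (bernoulliWeight p) (ind H)) * ex (bernoulliWeight p) (ind H * u * v)

/-- The "same-pattern" part `m′(f,g) = D(fg) − d(f,g)` of the one-step splitting `T = m′ + n`. [this work] -/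
def osMp (p : ι → unitInterval) (H : Set (Set ι)) (f g : Set ι → ℝ) : ℝ :=
  osD p H (f * g) - osCert p H f g

/-- The "antithetic-pattern" part `n(f,g) = d(f,g) − S(f,g)`, `S(f,g) = E[1_H f]E[g] + E[1_H g]E[f] − E[1_H]E[f]E[g]`. [this work] -/
def osN (p : ι → unitInterval) (H : Set (Set ι)) (f g : Set ι → ℝ) : ℝ :=
  osCert p H f g
    - (ex (bernoulliWeight p) (ind H * f) * ex (bernoulliWeight p) g
        + ex (bernoulliWeight p) (ind H * g) * ex (bernoulliWeight p) f
        - ex (bernoulliWeight p) (ind H) * ex (bernoulliWeight p) f * ex (bernoulliWeight p) g)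

/-- **Main part of the one-step certificate**: `M_K(f,g) = Σ_{x ⊆ K} [m′(f^x, g^x) + n(f^x, g^{K∖x})]`. [this work] -/
def osM (p : ι → unitInterval) (H : Set (Set ι)) (K : Finset ι) (f g : Set ι → ℝ) : ℝ :=
  ∑ x ∈ K.powerset, (osMp p H (sec K x f) (sec K x g) + osN p H (sec K x f) (sec K (K \ x) g))


/-- A **core test function** for the block `F`: increasing, `[0,1]`-valued, depending only on the coordinates in `F`
(the sections `f^x` of increasing `[0,1]`-valued functions in the base case of the tower are such). [this work] -/
def IsCoreFn (F : Finset ι) (φ : Set ι → ℝ) : Prop :=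
  Monotone φ ∧ (∀ ω, 0 ≤ φ ω ∧ φ ω ≤ 1) ∧ ∀ ω, φ ω = φ (ω ∩ (F : Set ι))

/-- **The one-step positivity hypothesis** for the first event `H` on the block `F`: both halves `m′` and `n` of the splitting
`T = m′ + n` are nonnegative on all pairs of core test functions (conditions (3′), (2′) of the memo; for the canonical certificate
they read `Cov(1_{H∩A},1_{H∩B}) ≥ π(H)π(A∩B∖H)` and `Cov(A,B) ≥ π(Hᶜ)·Cov(A,B ∣ Hᶜ)` on up-sets `A, B` of `2^F`). [this work] -/
def OneStepPos (p : ι → unitInterval) (H : Set (Set ι)) (F : Finset ι) : Prop :=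
  ∀ φ ψ : Set ι → ℝ, IsCoreFn F φ → IsCoreFn F ψ → 0 ≤ osMp p H φ ψ ∧ 0 ≤ osN p H φ ψ

/-! ## Elementary identities -/

/-- `P_∅ = T`. [this work] -/
theorem osP_empty (p : ι → unitInterval) (H : Set (Set ι)) (f g : Set ι → ℝ) :
    osP p H ∅ f g = osT p H f g := by
  unfold osP
  rw [Finset.powerset_empty, Finset.sum_singleton, Finset.sdiff_empty]
  have hsec : ∀ h : Set ι → ℝ, sec (∅ : Finset ι) ∅ h = h := fun h => by
    funext ω; simp [sec]
  rw [hsec, hsec, sub_self, mul_zero]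
  have hD : osD p H (0 : Set ι → ℝ) = 0 := by
    unfold osD ex; simp
  rw [hD, add_zero]

omit [DecidableEq ι] in
/-- `D(h) = 2E[1_H h] − E[1_H]·E[h]`. [this work] -/
theorem osD_eq (p : ι → unitInterval) (H : Set (Set ι)) (h : Set ι → ℝ) :
    osD p H h = 2 * ex (bernoulliWeight p) (ind H * h) -
      ex (bernoulliWeight p) (ind H) * ex (bernoulliWeight p) h := by
  unfold osD
  rw [ex_congr' (fun ω => show (2 * ind H ω - ex (bernoulliWeight p) (ind H)) * h ω =
      2 * (ind H * h) ω + (- ex (bernoulliWeight p) (ind H)) * h ω from by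
        simp only [Pi.mul_apply]; ring), ex_lin2]
  ring

omit [DecidableEq ι] in
/-- **The one-step splitting** `T = m′ + n`. [this work] -/
theorem osT_eq_osMp_add_osN (p : ι → unitInterval) (H : Set (Set ι)) (f g : Set ι → ℝ) :
    osT p H f g = osMp p H f g + osN p H f g := by
  unfold osMp osN osT
  rw [osD_eq]
  have h1 : ex (bernoulliWeight p) (ind H * (f * g)) = ex (bernoulliWeight p) (ind H * f * g) := by
    rw [mul_assoc]
  rw [h1]
  ring

/-- `M_∅ = T`. [this work] -/
theorem osM_empty (p : ι → unitInterval) (H : Set (Set ι)) (f g : Set ι → ℝ) :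
    osM p H ∅ f g = osT p H f g := by
  unfold osM
  rw [Finset.powerset_empty, Finset.sum_singleton, Finset.sdiff_empty]
  have hsec : ∀ h : Set ι → ℝ, sec (∅ : Finset ι) ∅ h = h := fun h => by
    funext ω; simp [sec]
  rw [hsec, hsec, osT_eq_osMp_add_osN]

omit [DecidableEq ι] in
/-- `D` on a product `φ·(ψ − χ)`. [this work] -/
theorem osD_mul_sub (p : ι → unitInterval) (H : Set (Set ι)) (φ ψ χ : Set ι → ℝ) :
    osD p H (fun ω => φ ω * (ψ ω - χ ω)) =
      2 * (ex (bernoulliWeight p) (ind H * φ * ψ) - ex (bernoulliWeight p) (ind H * φ * χ)) -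
        ex (bernoulliWeight p) (ind H) *
          (ex (bernoulliWeight p) (φ * ψ) - ex (bernoulliWeight p) (φ * χ)) := by
  rw [osD_eq]
  have h1 : ex (bernoulliWeight p) (ind H * fun ω => φ ω * (ψ ω - χ ω)) =
      ex (bernoulliWeight p) (ind H * φ * ψ) - ex (bernoulliWeight p) (ind H * φ * χ) := by
    rw [ex_congr' (fun ω => show (ind H * fun ω => φ ω * (ψ ω - χ ω)) ω =
      1 * (ind H * φ * ψ) ω + (-1) * (ind H * φ * χ) ω from by simp only [Pi.mul_apply]; ring), ex_lin2]
    ring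
  have h2 : ex (bernoulliWeight p) (fun ω => φ ω * (ψ ω - χ ω)) =
      ex (bernoulliWeight p) (φ * ψ) - ex (bernoulliWeight p) (φ * χ) := by
    rw [ex_congr' (fun ω => show φ ω * (ψ ω - χ ω) = 1 * (φ * ψ) ω + (-1) * (φ * χ) ω from by
      simp only [Pi.mul_apply]; ring), ex_lin2]
    ring
  rw [h1, h2]

omit [DecidableEq ι] in
/-- `D` on a product of differences `(φ − φ')·(ψ − ψ')`. [this work] -/
theorem osD_sub_mul_sub (p : ι → unitInterval) (H : Set (Set ι)) (φ φ' ψ ψ' : Set ι → ℝ) :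
    osD p H (fun ω => (φ ω - φ' ω) * (ψ ω - ψ' ω)) =
      2 * (ex (bernoulliWeight p) (ind H * φ * ψ) - ex (bernoulliWeight p) (ind H * φ * ψ')
          - ex (bernoulliWeight p) (ind H * φ' * ψ) + ex (bernoulliWeight p) (ind H * φ' * ψ')) -
        ex (bernoulliWeight p) (ind H) *
          (ex (bernoulliWeight p) (φ * ψ) - ex (bernoulliWeight p) (φ * ψ')
            - ex (bernoulliWeight p) (φ' * ψ) + ex (bernoulliWeight p) (φ' * ψ')) := by
  rw [osD_eq]
  have h1 : ex (bernoulliWeight p) (ind H * fun ω => (φ ω - φ' ω) * (ψ ω - ψ' ω)) =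
      ex (bernoulliWeight p) (ind H * φ * ψ) - ex (bernoulliWeight p) (ind H * φ * ψ')
        - ex (bernoulliWeight p) (ind H * φ' * ψ) + ex (bernoulliWeight p) (ind H * φ' * ψ') := by
    rw [ex_congr' (fun ω => show (ind H * fun ω => (φ ω - φ' ω) * (ψ ω - ψ' ω)) ω =
      1 * (ind H * φ * ψ) ω + (-1) * (ind H * φ * ψ') ω + (-1) * (ind H * φ' * ψ) ω
        + 1 * (ind H * φ' * ψ') ω from by simp only [Pi.mul_apply]; ring), ex_lin4]
    ring
  have h2 : ex (bernoulliWeight p) (fun ω => (φ ω - φ' ω) * (ψ ω - ψ' ω)) =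
      ex (bernoulliWeight p) (φ * ψ) - ex (bernoulliWeight p) (φ * ψ') - ex (bernoulliWeight p) (φ' * ψ)
        + ex (bernoulliWeight p) (φ' * ψ') := by
    rw [ex_congr' (fun ω => show (φ ω - φ' ω) * (ψ ω - ψ' ω) =
      1 * (φ * ψ) ω + (-1) * (φ * ψ') ω + (-1) * (φ' * ψ) ω + 1 * (φ' * ψ') ω from by simp only [Pi.mul_apply]; ring), ex_lin4]
    ring
  rw [h1, h2]

end SahiOneStep

end Summit.CriticalPhenomena.PercolationContinuityZ3.Theorems
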